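import Summits.ValiantsHypothesis.ValiantsHypothesis.Theorems.KPlusLogSqLawStaticPathCertNineteenPart7
import Summits.ValiantsHypothesis.ValiantsHypothesis.Theorems.KPlusLogSqLawStaticPathChainFloorAdjacent

/-!
# Route «KPlusLogSqLaw» — KERNEL FLOOR `34·⌊m/19⌋` (rate `34/19`) for the static path sector's tropical count

HONEST FRAMING.  Helper toward the crux `WeakLifting` (item `stmt-ValiantsHypothesis-19561`, route `KPlusLogSqLaw`, cell `pub-symmetroid`,
seat val-sym-lift-p4 g10, 2026-08-27): tropical twin of the STATIC tridiagonal sector = parametric max-weight independent set on a path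
(a block of `m` items with item lines `W t θ = w₁ t θ + w₀ t`; a «chain of N changes» = `N + 1` parameters with pairwise distinct UNIQUE optima,
the kernel currency of `…StaticPathChain*`).  The located `n = 19` instance with `34 = 2·19 − 4` changes (val-sym-lift-p4 g10,
`HOME/val-sym-lift-p4/g10/data/located_g10.txt`; kernel certificate `exists_chain_thirtyfour_on_nineteen_rev_ends`, parts `…CertNineteenPart1..7`)
has, after time reversal (`exists_chain_ends_of_rev_ends`, g9), the FREE ENDS of the separator-free gluing (`exists_chain_floor_adj`,
`…ChainFloorAdjacent`): `34·⌊m/19⌋` changes of the unique optimum on EVERY `m`-block — asymptotic rate `34/19 ≈ 1.789` changes per item, above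
the kernel floors `26/15` (g9), `28/16` and `30/17` (`…ChainFloorSixteen`, `…ChainFloorSeventeen`, this seat); the located all-`n` family F6 (rate
`11/6 ≈ 1.833`, LINEAR-LAW §4.5) is still not in the kernel, and the kernel CEILING is `O(n log n)` (`exists_cert_opt`, lift-p3 g6).
Nothing here asserts anything about `WeakLifting`, `TropicalB`, `KPlusLogSqLaw`, the stub `stub_tridiagonalSectorB` in its window,
`MatrixDescartes` (stmt-ValiantsHypothesis-18050) or `VP ≠ VNP`.
-/

set_option linter.dupNamespace false
set_option autoImplicit false

namespace Summit.ValiantsHypothesis.ValiantsHypothesis.Theorems.KPlusLogSqLaw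

open Finset Classical

namespace StaticPathFold

noncomputable section

/-- **the `n = 19` certificate with free ends** (time-reversed located instance): 34 changes on 19 items, first optimum avoiding item `1`,
last optimum avoiding item `19`. [folklore] -/
theorem exists_chain_ends_nineteen :
    ∃ (w₁ w₀ : ℕ → ℝ) (θs : Fin (34 + 1) → ℝ) (Ms : Fin (34 + 1) → Finset ℕ),
      StrictMono θs ∧ (∀ k, Ms k ∈ indepSets 0 19) ∧
      (∀ k, ∀ S ∈ indepSets 0 19, S ≠ Ms k → ∑ t ∈ S, W w₁ w₀ t (θs k) < ∑ t ∈ Ms k, W w₁ w₀ t (θs k)) ∧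
      (∀ e : Fin 34, Ms e.castSucc ≠ Ms e.succ) ∧ 1 ∉ Ms 0 ∧ 19 ∉ Ms (Fin.last 34) :=
  exists_chain_ends_of_rev_ends exists_chain_thirtyfour_on_nineteen_rev_ends

/-- **KERNEL FLOOR `34·⌊m/19⌋` ON EVERY `m`-BLOCK** (the located `n = 19` instance glued to itself without separators; rate `34/19`,
the sector's best kernel floor as of this file; located truth `2n − 4` for `5 ≤ n ≤ 19`). [folklore] -/
theorem exists_chain_floor_nineteen_adj (m : ℕ) :
    ∃ (w₁ w₀ : ℕ → ℝ) (θs : Fin (34 * (m / 19) + 1) → ℝ) (Ms : Fin (34 * (m / 19) + 1) → Finset ℕ),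
      StrictMono θs ∧ (∀ j, Ms j ∈ indepSets 0 m) ∧
      (∀ j, ∀ S ∈ indepSets 0 m, S ≠ Ms j → ∑ t ∈ S, W w₁ w₀ t (θs j) < ∑ t ∈ Ms j, W w₁ w₀ t (θs j)) ∧
      (∀ e : Fin (34 * (m / 19)), Ms e.castSucc ≠ Ms e.succ) :=
  exists_chain_floor_adj exists_chain_ends_nineteen m

/-- the rate of the floor: `34·⌊m/19⌋ ≥ (34 m − 612)/19`, i.e. asymptotic rate `34/19` changes per item. [folklore] -/
theorem floor_nineteen_adj_rate (m : ℕ) : 34 * m ≤ 19 * (34 * (m / 19)) + 612 := by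
  have := Nat.div_add_mod m 19
  have := Nat.mod_lt m (show 0 < 19 by norm_num)
  omega

/-- the new floor constant beats the previous ones: `34/19 > 30/17` (as `34·17 > 30·19`). [folklore] -/
theorem floor_nineteen_rate_gt : 30 * 19 < 34 * 17 := by norm_num

end

end StaticPathFold

end Summit.ValiantsHypothesis.ValiantsHypothesis.Theorems.KPlusLogSqLaw
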